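import Mathlib
import Summits.PneNP.PneNP.Theorems.CnfIdealGenLengthRankDefectRepresentationsTwoFamilyCutDomination
import Summits.PneNP.PneNP.Theorems.CnfIdealGenLengthRankDefectRepresentationsQuadrantCapture

/-!
# Crux `RankDefectRepresentations` (stmt-PneNP-18923), line `rank-dehn-ladder`: HALVES BUDGET ADDITIVITY — with zero cross data at the
# last second-family coordinate, every double cut is the SUM of the two halves' double cuts (lead g15 RESHAPE 9, tool stub W1
# `stub_halvesBudget`; memo `Cruxes/RankDefectRepresentations/Lines/rank-dehn-ladder-g15.md` §2, briefs `…-briefs-g15.md` §W1)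

MERGE setting: the second family has `n' + 1` coordinates and the data `D` has ZERO CROSS DATA at the last one (`D x y = 0` whenever the last
second-family bits of the row `x` and of the column `y` differ).  Write `D = H₀ + H₁`, `H_b` = the cells whose row AND column last bits are `b`
(`Matrix.of fun x y => if row x (Sum.inr (Fin.last n')) = b ∧ col y (Sum.inr (Fin.last n')) = b then D x y else 0`).
For every first-family gate `A` (here: the two `B`-antidiagonal blocks of `doubleCut`) the `A`-gated `B′`-mask of `D` is, entrywise, the sum of the
`A`-gated `(B′.filter (last = b))`-masks of `H_b` (`gate_maskJ_eq_add`: on a cell of `H_b`, membership of a second-family colour in `B′` is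
membership in `B′.filter (last = b)`; cross cells vanish), and the two summands have disjoint row supports and disjoint column supports (last bit
`false` / `true`), so their ranks add (`Summit.PneNP.PneNP.Theorems.CnfIdealGenLengthRankDefectRepresentationsQuadrantCapture.rank_add_of_disjoint`;
`rank_gate_maskJ_eq_add`).  Applied to both blocks of `doubleCut` this is the exact budget splitting, pointwise in the first-family argument `B`
(`stub_halvesBudget`, the registered signature verbatim).
HONEST FRAMING: elementary linear algebra; a tool for the MERGE step of the line; `stub_merge` and the crux stay open; P ≠ NP is not moved;
F-N2 is a FRONTIER formal rung.
-/

set_option linter.dupNamespace false -- `Summit.PneNP.PneNP.…`: summit = sub-problem name (D-0017)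

namespace Summit.PneNP.PneNP.Theorems.CnfIdealGenLengthRankDefectRepresentationsHalvesBudget

open Matrix Finset
open Summit.PneNP.PneNP.Theorems.CnfIdealGenLengthRankDefectRepresentationsTwoFamilyCutDomination (colourI colourJ maskJ doubleCut)
open Summit.PneNP.PneNP.Theorems.CnfIdealGenLengthRankDefectRepresentationsQuadrantCapture (rank_add_of_disjoint)

variable {K : Type} [Field K]

section Halves

variable {n n' : ℕ} {ι ι' : Type} [Fintype ι] [Fintype ι'] [DecidableEq ι] [DecidableEq ι']
variable (row : ι → Fin n ⊕ Fin (n' + 1) → Bool) (col : ι' → Fin n ⊕ Fin (n' + 1) → Bool)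

omit [Fintype ι] [Fintype ι'] [DecidableEq ι] [DecidableEq ι'] in
/-- **Entrywise splitting.**  With zero cross data at the last coordinate, for every gate `A` the `A`-gated `B′`-mask of `D` is the sum of the
`A`-gated `(B′.filter (last = false))`-mask of the half `H₀` (cells with row AND column last bits `false`) and the `A`-gated
`(B′.filter (last = true))`-mask of the half `H₁` (last bits `true`). -/
theorem gate_maskJ_eq_add (D : Matrix ι ι' K)
    (hcross : ∀ x y, row x (Sum.inr (Fin.last n')) ≠ col y (Sum.inr (Fin.last n')) → D x y = 0)
    (A : ι → ι' → Prop) [∀ x y, Decidable (A x y)] (B' : Finset (Fin (n' + 1) → Bool)) :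
    (Matrix.of fun x y => if A x y then maskJ row col B' D x y else 0) =
      (Matrix.of fun x y =>
          if A x y then
            maskJ row col (B'.filter fun σ => σ (Fin.last n') = false)
              (Matrix.of fun x y =>
                if row x (Sum.inr (Fin.last n')) = false ∧ col y (Sum.inr (Fin.last n')) = false then D x y else 0) x y
          else 0) +
        (Matrix.of fun x y =>
          if A x y then
            maskJ row col (B'.filter fun σ => σ (Fin.last n') = true)
              (Matrix.of fun x y =>
                if row x (Sum.inr (Fin.last n')) = true ∧ col y (Sum.inr (Fin.last n')) = true then D x y else 0) x y
          else 0) := by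
  ext x y
  simp only [Matrix.add_apply, Matrix.of_apply, maskJ, Finset.mem_filter, colourJ]
  by_cases hA : A x y
  · simp only [if_pos hA]
    cases hr : row x (Sum.inr (Fin.last n')) <;> cases hc : col y (Sum.inr (Fin.last n'))
    · simp
    · have h0 : D x y = 0 := hcross x y (by rw [hr, hc]; decide)
      simp [h0]
    · have h0 : D x y = 0 := hcross x y (by rw [hr, hc]; decide)
      simp [h0]
    · simp
  · simp only [if_neg hA, add_zero]

/-- **Rank splitting.**  With zero cross data at the last coordinate, for every gate `A` the rank of the `A`-gated `B′`-mask of `D` is the SUM of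
the ranks of the two gated half-masks: they occupy disjoint rows (last row bit `false` / `true`) and disjoint columns (last column bit
`false` / `true`), so `rank_add_of_disjoint` applies. -/
theorem rank_gate_maskJ_eq_add (D : Matrix ι ι' K)
    (hcross : ∀ x y, row x (Sum.inr (Fin.last n')) ≠ col y (Sum.inr (Fin.last n')) → D x y = 0)
    (A : ι → ι' → Prop) [∀ x y, Decidable (A x y)] (B' : Finset (Fin (n' + 1) → Bool)) :
    (Matrix.of fun x y => if A x y then maskJ row col B' D x y else 0).rank =
      (Matrix.of fun x y =>
          if A x y then
            maskJ row col (B'.filter fun σ => σ (Fin.last n') = false)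
              (Matrix.of fun x y =>
                if row x (Sum.inr (Fin.last n')) = false ∧ col y (Sum.inr (Fin.last n')) = false then D x y else 0) x y
          else 0).rank +
        (Matrix.of fun x y =>
          if A x y then
            maskJ row col (B'.filter fun σ => σ (Fin.last n') = true)
              (Matrix.of fun x y =>
                if row x (Sum.inr (Fin.last n')) = true ∧ col y (Sum.inr (Fin.last n')) = true then D x y else 0) x y
          else 0).rank := by
  rw [gate_maskJ_eq_add row col D hcross A B']
  refine rank_add_of_disjoint (fun x => row x (Sum.inr (Fin.last n')) = false) (fun y => col y (Sum.inr (Fin.last n')) = false) _ _ ?_ ?_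
  · intro x y h
    simp only [Matrix.of_apply, maskJ, if_neg h]
    split_ifs <;> rfl
  · intro x y h
    have h' : ¬ (row x (Sum.inr (Fin.last n')) = true ∧ col y (Sum.inr (Fin.last n')) = true) := by
      simpa only [Bool.not_eq_false] using h
    simp only [Matrix.of_apply, maskJ, if_neg h']
    split_ifs <;> rfl

end Halves

/-- **HALVES BUDGET ADDITIVITY** (registered tool stub W1 `stub_halvesBudget` of the skeleton `Lines/rank_dehn_ladder.lean`, signature verbatim).
In the MERGE setting (`n' + 1` second-family coordinates, ZERO cross data at the last coordinate) every double cut of `D` is the SUM of the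
corresponding double cuts of the two halves `{σ_last = b}` — each half as the matrix of cells whose row AND column last bits are `b`, the
second-family set restricted to the colours with last bit `b`: both `B`-antidiagonal blocks of `doubleCut` split by `rank_gate_maskJ_eq_add`. -/
theorem stub_halvesBudget :
    ∀ (K : Type) [Field K] (n n' : ℕ) (ι ι' : Type) [Fintype ι] [Fintype ι'] [DecidableEq ι] [DecidableEq ι']
      (row : ι → Fin n ⊕ Fin (n' + 1) → Bool) (col : ι' → Fin n ⊕ Fin (n' + 1) → Bool) (D : Matrix ι ι' K),
      (∀ x y, row x (Sum.inr (Fin.last n')) ≠ col y (Sum.inr (Fin.last n')) → D x y = 0) →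
      ∀ (B : Finset (Fin n → Bool)) (B' : Finset (Fin (n' + 1) → Bool)),
        Summit.PneNP.PneNP.Theorems.CnfIdealGenLengthRankDefectRepresentationsTwoFamilyCutDomination.doubleCut row col B B' D =
          Summit.PneNP.PneNP.Theorems.CnfIdealGenLengthRankDefectRepresentationsTwoFamilyCutDomination.doubleCut row col B
              (B'.filter fun σ => σ (Fin.last n') = false)
              (Matrix.of fun x y =>
                if row x (Sum.inr (Fin.last n')) = false ∧ col y (Sum.inr (Fin.last n')) = false then D x y else 0) +
          Summit.PneNP.PneNP.Theorems.CnfIdealGenLengthRankDefectRepresentationsTwoFamilyCutDomination.doubleCut row col B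
              (B'.filter fun σ => σ (Fin.last n') = true)
              (Matrix.of fun x y =>
                if row x (Sum.inr (Fin.last n')) = true ∧ col y (Sum.inr (Fin.last n')) = true then D x y else 0) := by
  intro K _ n n' ι ι' _ _ _ _ row col D hcross B B'
  unfold doubleCut
  rw [rank_gate_maskJ_eq_add row col D hcross (fun x y => colourI (row x) ∈ B ∧ colourI (col y) ∉ B) B',
    rank_gate_maskJ_eq_add row col D hcross (fun x y => colourI (row x) ∉ B ∧ colourI (col y) ∈ B) B']
  exact Nat.add_add_add_comm _ _ _ _

end Summit.PneNP.PneNP.Theorems.CnfIdealGenLengthRankDefectRepresentationsHalvesBudget
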